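import Summits.HodgeConjecture.HodgeConjecture.Theorems.MarkmanPartnerTransportLatticeBridgeComplexification
import Literature.AlgebraicGeometry.Motives.HodgeStructurePseudoPolarizedProofs
import Summits.HodgeConjecture.HodgeConjecture.Theorems.AnchorTransportAnchorExistenceK3SquareCMFloorPolarization

/-!
# Route MarkmanPartnerTransport · lattice bridge, II: the transcendental Hodge structure of a period
# datum, irreducible of K3 type and polarized (generic index type)

Generic-index version of `Theorems/AnchorTransportAnchorExistenceK3SquareCMFloor{Transcendental,Polarization}`
(there `ι = K3Index`). A **period datum** on `ℚ^ι` (`PeriodDatum ι`) packages what a marked period of a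
projective K3 surface, of a projective `K3^{[2]}`-type fourfold (BBF form), or of any lattice-polarised
family supplies in coordinates: compatible symmetric forms `B` on `ℚ^ι` and `B_ℂ` on `ℂ^ι` (`B_ℂ` real,
`B` non-degenerate), a splitting `ℚ^ι = N ⊕ T` with `T = N^⊥` and `N` = the rational vectors orthogonal
to the period `x` and to `x̄` (the rational `(1,1)`-vectors), the period `x ∈ T_ℂ` with `(x.x) = 0`,
`Re (x̄.x) > 0`, and the Hodge-index input "`Re (v.v̄) < 0` for `0 ≠ v ∈ T_ℂ ∩ {x, x̄}^⊥`". From it this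
file CONSTRUCTS on the tree's abstract carriers (`Motives/HodgeStructure`, `HodgeStructure.ofPeriod`):
the period `ω ∈ ℂ ⊗_ℚ T` (`ι_T ω = x`), the weight-two Hodge structure `hodgeT` of K3 type on `T`, its
polarization `polT = -B|_T` (its irreducibility, Huybrechts Ch. 3 Lemma 3.1, is in the sequel
`…LatticeBridgeSpan`) — after which Zarhin's and van Geemen's theorems of the tree apply to `T`. Consumer: the `X`-side one-cycle theorem of crux #5
(`…K3Sq2OneCycle`). Pure linear algebra (two auxiliary lemmas are the tree's, `AnchorExistenceCMFloor.neg_baseChange_apply`,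
`AnchorExistenceCMFloor.two_lt_abs_sub`); no named fact, no sorry. Prover seat hodge-nonav-19652-p1 (gen 8),
`--supports stmt-HodgeConjecture-19653`.

References: D. Huybrechts, *Lectures on K3 Surfaces*, Ch. 3 §1.2 Def. 1.6, §2.2 Def. 2.3/2.5, Lemma 3.3.1,
§3.3.5; C. Voisin, *Hodge Theory and Complex Algebraic Geometry I*, §7.1.
-/

noncomputable section

set_option linter.dupNamespace false

open scoped TensorProduct
open Module
open Literature.AlgebraicGeometry.Motives Literature.AlgebraicGeometry.Motives.HodgeStructure
open Summit.HodgeConjecture.HodgeConjecture.Theorems.NikulinTwinTransport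

namespace Summit.HodgeConjecture.HodgeConjecture.Theorems.MarkmanPartnerTransport.LatticeBridge

/-! ### Period data -/

/-- **A period datum on `ℚ^ι`**: compatible symmetric forms `B` (rational, non-degenerate) and `B_ℂ`
(complex, real), a splitting `ℚ^ι = N ⊕ T` with `T = N^⊥` and `N = {v ∈ ℚ^ι | (v.x) = (v.x̄) = 0}`, a
period `x ∈ T_ℂ` with `(x.x) = 0`, `Re (x̄.x) > 0`, and the Hodge index on `T_ℂ ∩ {x,x̄}^⊥` — the
coordinate shadow of a marked projective K3 surface / `K3^{[2]}`-type fourfold (`N = NS_ℚ`, `T = T_ℚ`).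
[cite: Huybrechts2016K3, Ch. 3 Lemma 3.3.1 and §3.3.5] -/
structure PeriodDatum (ι : Type*) [Fintype ι] [DecidableEq ι] where
  /-- The rational form on `ℚ^ι`. -/
  B : LinearMap.BilinForm ℚ (ι → ℚ)
  /-- The complex form on `ℂ^ι`. -/
  BC : LinearMap.BilinForm ℂ (ι → ℂ)
  /-- The rational `(1,1)`-vectors. -/
  N : Submodule ℚ (ι → ℚ)
  /-- The transcendental lattice `T = N^⊥`. -/
  T : Submodule ℚ (ι → ℚ)
  /-- The period. -/
  x : ι → ℂ
  /-- `B_ℂ` restricts to `B` on rational vectors. -/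
  ratCast_form : ∀ v w : ι → ℚ, BC (fun i => (v i : ℂ)) (fun i => (w i : ℂ)) = ((B v w : ℚ) : ℂ)
  /-- `B` is symmetric. -/
  B_comm : ∀ a b, B a b = B b a
  /-- `B_ℂ` is symmetric. -/
  BC_comm : ∀ a b, BC a b = BC b a
  /-- `B_ℂ` is real. -/
  BC_star : ∀ a b, BC (star a) (star b) = star (BC a b)
  /-- `B` is non-degenerate. -/
  nondegenerate : B.Nondegenerate
  /-- `ℚ^ι = N ⊕ T`. -/
  isCompl : IsCompl N T
  /-- `T = N^⊥`. -/
  mem_T_iff : ∀ t, t ∈ T ↔ ∀ n ∈ N, B n t = 0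
  /-- `N` = the rational vectors orthogonal to `x` and `x̄`. -/
  mem_N_iff : ∀ v : ι → ℚ, v ∈ N ↔ BC (fun i => (v i : ℂ)) x = 0 ∧ BC (fun i => (v i : ℂ)) (star x) = 0
  /-- `x ∈ T_ℂ`. -/
  period_mem : x ∈ Submodule.span ℂ (Set.range fun t : T => fun i => ((t : ι → ℚ) i : ℂ))
  /-- `(x.x) = 0`. -/
  period_sq : BC x x = 0
  /-- `Re (x̄.x) > 0`. -/
  period_pos : 0 < (BC (star x) x).re
  /-- Hodge index: `Re (v.v̄) < 0` for `0 ≠ v ∈ T_ℂ` orthogonal to `x` and `x̄`. -/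
  neg : ∀ v ∈ Submodule.span ℂ (Set.range fun t : T => fun i => ((t : ι → ℚ) i : ℂ)),
    BC v x = 0 → BC v (star x) = 0 → v ≠ 0 → (BC v (star v)).re < 0

namespace PeriodDatum

variable {ι : Type*} [Fintype ι] [DecidableEq ι] (D : PeriodDatum ι)

/-! ### Elementary consequences -/

/-- `B` is reflexive. [folklore] -/
theorem isRefl : D.B.IsRefl := fun a b h => by rw [D.B_comm]; exact h

/-- `T = N^⊥`. [cite: Huybrechts2016K3, Ch. 3 Lemma 3.3.1] -/
theorem T_eq_orthogonal : D.T = D.B.orthogonal D.N := by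
  ext t
  rw [D.mem_T_iff, LinearMap.BilinForm.mem_orthogonal_iff]

/-- `N ⊥ T`. [folklore] -/
theorem B_eq_zero_of_mem {n t : ι → ℚ} (hn : n ∈ D.N) (ht : t ∈ D.T) : D.B n t = 0 ∧ D.B t n = 0 := by
  have h := (D.mem_T_iff t).1 ht n hn
  exact ⟨h, by rw [D.B_comm]; exact h⟩

/-- **The form restricted to `T` is non-degenerate** (`N^⊥⊥ = N`). [cite: Huybrechts2016K3, Ch. 3 Lemma 3.3.1] -/
theorem restrict_nondegenerate : (D.B.restrict D.T).Nondegenerate := by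
  have hNN : D.B.orthogonal D.T = D.N := by
    rw [D.T_eq_orthogonal, LinearMap.BilinForm.orthogonal_orthogonal D.nondegenerate D.isRefl]
  exact D.B.nondegenerate_restrict_of_disjoint_orthogonal D.isRefl (by rw [hNN]; exact D.isCompl.symm.disjoint)

/-- Rational vectors: orthogonal to `x̄` iff orthogonal to `x` (`B_ℂ` is real). [folklore] -/
theorem ratCast_period_eq_zero_iff (v : ι → ℚ) :
    D.BC (fun i => (v i : ℂ)) (star D.x) = 0 ↔ D.BC (fun i => (v i : ℂ)) D.x = 0 := by
  have h : D.BC (fun i => (v i : ℂ)) (star D.x) = star (D.BC (fun i => (v i : ℂ)) D.x) := by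
    rw [← D.BC_star, star_ratVec]
  rw [h, star_eq_zero]

/-- **A rational vector of `T` orthogonal to the period is zero** (`t ∈ N ∩ T = 0`).
[cite: Huybrechts2016K3, Ch. 3 Lemma 3.1] -/
theorem eq_zero_of_mem_T {t : ι → ℚ} (ht : t ∈ D.T) (htx : D.BC (fun i => (t i : ℂ)) D.x = 0) : t = 0 := by
  have htN : t ∈ D.N := (D.mem_N_iff t).2 ⟨htx, (D.ratCast_period_eq_zero_iff t).2 htx⟩
  exact Submodule.disjoint_def.1 D.isCompl.disjoint t htN ht

/-- Vectors of `N` are orthogonal to the period (both orders). [folklore] -/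
theorem BC_period_of_mem {n : ι → ℚ} (hn : n ∈ D.N) :
    D.BC D.x (fun i => (n i : ℂ)) = 0 ∧ D.BC (star D.x) (fun i => (n i : ℂ)) = 0 := by
  obtain ⟨h1, h2⟩ := (D.mem_N_iff n).1 hn
  exact ⟨by rw [D.BC_comm, h1], by rw [D.BC_comm, h2]⟩

/-- **`T_ℂ ⊥ N`**: `(ι_T z . n) = 0` for `n ∈ N`. [cite: Huybrechts2016K3, Ch. 3 Lemma 3.3.1] -/
theorem BC_iota_of_mem (z : ℂ ⊗[ℚ] D.T) {n : ι → ℚ} (hn : n ∈ D.N) :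
    D.BC (iota D.T z) (fun i => (n i : ℂ)) = 0 := by
  induction z using TensorProduct.induction_on with
  | zero => rw [map_zero, LinearMap.BilinForm.zero_left]
  | tmul c t =>
    rw [iota_tmul, LinearMap.BilinForm.smul_left, D.ratCast_form, (D.B_eq_zero_of_mem hn t.2).2, Rat.cast_zero,
      mul_zero]
  | add a b ha hb => rw [map_add, LinearMap.BilinForm.add_left, ha, hb, add_zero]

/-- `(x.x̄)` is the positive real `Re (x̄.x)`, hence non-zero. [cite: Huybrechts2016K3, Ch. 6 §1.1] -/
theorem BC_self_star_period :
    D.BC D.x (star D.x) = ((D.BC (star D.x) D.x).re : ℂ) ∧ D.BC D.x (star D.x) ≠ 0 := by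
  have hreal : star (D.BC (star D.x) D.x) = D.BC (star D.x) D.x := by
    rw [← D.BC_star, star_star, D.BC_comm]
  have him : (D.BC (star D.x) D.x).im = 0 := by
    have h := congrArg Complex.im hreal
    rw [Complex.star_def, Complex.conj_im] at h
    linarith
  have hre : D.BC (star D.x) D.x = ((D.BC (star D.x) D.x).re : ℂ) := by
    apply Complex.ext
    · simp
    · simp [him]
  rw [D.BC_comm]
  refine ⟨hre, fun h0 => ?_⟩
  have h := D.period_pos
  rw [h0, Complex.zero_re] at h
  exact lt_irrefl _ h

/-- `(v.v̄)` is real. [folklore] -/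
theorem BC_self_star_im (v : ι → ℂ) : (D.BC v (star v)).im = 0 := by
  have hreal : star (D.BC v (star v)) = D.BC v (star v) := by
    rw [← D.BC_star, star_star, D.BC_comm]
  have h := congrArg Complex.im hreal
  rw [Complex.star_def, Complex.conj_im] at h
  linarith

/-! ### The period `ω ∈ ℂ ⊗_ℚ T` and the transcendental Hodge structure -/

/-- **The period as an element `ω` of `ℂ ⊗_ℚ T`** (`ι_T ω = x`). [cite: Huybrechts2016K3, Ch. 3 §2.2 Def. 2.5] -/
def omega : ℂ ⊗[ℚ] D.T := lam D.isCompl D.x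

/-- `ι_T ω = x`. [cite: Huybrechts2016K3, Ch. 3 §2.2 Def. 2.5] -/
theorem iota_omega : iota D.T D.omega = D.x := iota_lam_of_mem_span D.isCompl D.period_mem

/-- `ι_T (conj ω) = x̄`. [folklore] -/
theorem iota_conj_omega : iota D.T (conj D.omega) = star D.x := by
  rw [iota_conj, D.iota_omega]

/-- `(ω.ω) = 0`. [cite: Huybrechts2016K3, Ch. 6 Prop. 1.2 (i)] -/
theorem form_omega_omega : (D.B.restrict D.T).baseChange ℂ D.omega D.omega = 0 := by
  rw [restrict_baseChange_apply D.T D.ratCast_form, D.iota_omega, D.period_sq]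

/-- `(ω.ω̄) ≠ 0`. [cite: Huybrechts2016K3, Ch. 6 Prop. 1.2 (ii)] -/
theorem form_omega_conj_ne : (D.B.restrict D.T).baseChange ℂ D.omega (conj D.omega) ≠ 0 := by
  rw [restrict_baseChange_apply D.T D.ratCast_form, D.iota_omega, D.iota_conj_omega]
  exact D.BC_self_star_period.2

/-- **The transcendental Hodge structure** of the period datum: the weight-two Hodge structure of K3 type
on `T` defined by the period (`F² = ℂω`, `F¹ = ω^⊥`; the tree's `HodgeStructure.ofPeriod`).
[cite: Huybrechts2016K3, Ch. 3 §2.2 Def. 2.3, Def. 2.5 and Lemma 3.3.1] -/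
def hodgeT : HodgeStructure D.T 2 :=
  ofPeriod (D.B.restrict D.T) D.omega D.form_omega_omega D.form_omega_conj_ne

/-- The transcendental Hodge structure is of K3 type. [cite: Huybrechts2016K3, Ch. 3 Def. 2.3] -/
theorem isOfK3Type_hodgeT : D.hodgeT.IsOfK3Type := isOfK3Type_ofPeriod _ _

/-- `ω ≠ 0`. [folklore] -/
theorem omega_ne_zero : D.omega ≠ 0 := ne_zero_of_period D.form_omega_conj_ne

/-- `T^{2,0} = ℂ ω`. [cite: Huybrechts2016K3, Ch. 3 Def. 2.3 and Def. 2.5] -/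
theorem piece_two_zero_hodgeT : D.hodgeT.piece 2 0 = ℂ ∙ D.omega := piece_two_zero_ofPeriod _ _

/-- `ω ∈ T^{2,0}`. [folklore] -/
theorem omega_mem_piece : D.omega ∈ D.hodgeT.piece 2 0 := (mem_piece_two_zero_ofPeriod _ _).2 ⟨1, one_smul _ _⟩

/-! ### The polarization `-B|_T` -/

/-- The restricted form is symmetric. [folklore] -/
theorem restrict_symm (a b : D.T) : D.B.restrict D.T a b = D.B.restrict D.T b a := by
  rw [LinearMap.BilinForm.restrict_apply, LinearMap.BilinForm.restrict_apply, LinearMap.domRestrict_apply,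
    LinearMap.domRestrict_apply, D.B_comm]

/-- **The polarization of the transcendental Hodge structure by `-B|_T`**: the first Hodge–Riemann
relation is `(ω.ω) = 0`, `T^{1,1} ⊥ ω`; the second is `(x.x̄) > 0` on `T^{2,0}`, `T^{0,2}` and the Hodge
index `Re (v.v̄) < 0` on `T^{1,1}` (the datum's `neg`).
[cite: Huybrechts2016K3, Ch. 3 §1.2 Def. 1.6, Lemma 3.3.1 and §3.3.5] -/
def polT : D.hodgeT.Polarization where
  form := -(D.B.restrict D.T)
  flip_form := by
    rw [show (2 : ℤ).negOnePow = 1 from Int.negOnePow_even 2 even_two, Units.val_one, one_smul]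
    refine LinearMap.ext fun v => LinearMap.ext fun w => ?_
    rw [LinearMap.BilinForm.flip_apply, LinearMap.neg_apply, LinearMap.neg_apply, LinearMap.neg_apply,
      LinearMap.neg_apply, D.restrict_symm]
  form_apply_eq_zero := by
    intro p z hz z' hz'
    rw [AnchorExistenceCMFloor.neg_baseChange_apply, neg_eq_zero]
    change z ∈ periodF _ D.omega p at hz
    change z' ∈ periodF _ D.omega (2 + 1 - p) at hz'
    by_cases hp0 : p ≤ 0
    · rw [periodF_of_three_le _ _ (by omega), Submodule.mem_bot] at hz'
      rw [hz', map_zero]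
    by_cases hp1 : p = 1
    · subst hp1
      rw [show (2 : ℤ) + 1 - 1 = 2 by norm_num, mem_periodF_two] at hz'
      obtain ⟨c, rfl⟩ := hz'
      rw [mem_periodF_one] at hz
      rw [map_smul, smul_eq_mul, form_baseChange_symm D.restrict_symm z, hz, mul_zero]
    by_cases hp2 : p = 2
    · subst hp2
      rw [mem_periodF_two] at hz
      obtain ⟨c, rfl⟩ := hz
      rw [show (2 : ℤ) + 1 - 2 = 1 by norm_num, mem_periodF_one] at hz'
      rw [LinearMap.map_smul₂, smul_eq_mul, hz', mul_zero]
    · rw [periodF_of_three_le _ _ (by omega), Submodule.mem_bot] at hz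
      rw [hz, LinearMap.map_zero₂]
  pos := by
    intro p q hpq z hz hz0
    obtain ⟨hre, hne⟩ := D.BC_self_star_period
    have hB : ∀ a b : ℂ ⊗[ℚ] D.T,
        (-(D.B.restrict D.T)).baseChange ℂ a b = -D.BC (iota _ a) (iota _ b) :=
      fun a b => by rw [AnchorExistenceCMFloor.neg_baseChange_apply, restrict_baseChange_apply D.T D.ratCast_form]
    by_cases h20 : p = 2
    · subst h20
      obtain rfl : q = 0 := by omega
      obtain ⟨c, rfl⟩ := (mem_piece_two_zero_ofPeriod _ _).1 hz
      have hc : c ≠ 0 := by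
        rintro rfl
        exact hz0 (zero_smul _ _)
      refine ⟨Complex.normSq c * (D.BC (star D.x) D.x).re, mul_pos (Complex.normSq_pos.2 hc) D.period_pos, ?_⟩
      rw [hB, conj_smul, map_smul (iota D.T), map_smul (iota D.T), LinearMap.BilinForm.smul_left,
        LinearMap.BilinForm.smul_right, D.iota_omega, D.iota_conj_omega, hre, zpow_two, Complex.I_mul_I, zpow_zero,
        inv_one, mul_one, Complex.ofReal_mul, ← Complex.mul_conj]
      ring
    by_cases h02 : p = 0
    · subst h02
      obtain rfl : q = 2 := by omega
      obtain ⟨c, rfl⟩ := (mem_piece_zero_two_ofPeriod _ _).1 hz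
      have hc : c ≠ 0 := by
        rintro rfl
        exact hz0 (zero_smul _ _)
      refine ⟨Complex.normSq c * (D.BC (star D.x) D.x).re, mul_pos (Complex.normSq_pos.2 hc) D.period_pos, ?_⟩
      have hre' : D.BC (star D.x) D.x = ((D.BC (star D.x) D.x).re : ℂ) := by rw [← hre, D.BC_comm]
      rw [hB, conj_smul, conj_conj, map_smul (iota D.T), map_smul (iota D.T), LinearMap.BilinForm.smul_left,
        LinearMap.BilinForm.smul_right, D.iota_omega, D.iota_conj_omega, hre', zpow_two, Complex.I_mul_I,
        zpow_zero, Complex.ofReal_mul, ← Complex.mul_conj, Complex.ofReal_re]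
      ring
    by_cases h11 : p = 1
    · subst h11
      obtain rfl : q = 1 := by omega
      obtain ⟨hz1, hz2⟩ := (mem_piece_one_one_ofPeriod _ _).1 hz
      rw [restrict_baseChange_apply D.T D.ratCast_form, D.iota_omega] at hz1
      rw [restrict_baseChange_apply D.T D.ratCast_form, D.iota_conj_omega] at hz2
      set v := iota _ z with hv
      have hv0 : v ≠ 0 := fun h0 => hz0 (iota_injective _ (by rw [← hv, h0, map_zero]))
      have hneg := D.neg v (iota_mem_span D.T z) (by rw [D.BC_comm, hz1]) (by rw [D.BC_comm, hz2]) hv0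
      refine ⟨-(D.BC v (star v)).re, by linarith, ?_⟩
      have hvv : D.BC v (star v) = ((D.BC v (star v)).re : ℂ) := by
        apply Complex.ext
        · simp
        · simp [D.BC_self_star_im]
      rw [hB, ← hv, iota_conj, ← hv, zpow_one, mul_inv_cancel₀ Complex.I_ne_zero, one_mul]
      conv_rhs => rw [Complex.ofReal_neg, ← hvv]
    · exfalso
      have hbot := D.isOfK3Type_hodgeT.2 p q (AnchorExistenceCMFloor.two_lt_abs_sub hpq h20 h11 h02)
      rw [hbot, Submodule.mem_bot] at hz
      exact hz0 hz

/-- The transcendental Hodge structure is polarizable. [cite: Huybrechts2016K3, Ch. 3 Lemma 3.3.1] -/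
theorem isPolarizable_hodgeT : D.hodgeT.IsPolarizable := ⟨D.polT⟩

end PeriodDatum

end Summit.HodgeConjecture.HodgeConjecture.Theorems.MarkmanPartnerTransport.LatticeBridge

end
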